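import Summits.Schanuel.Schanuel.Theses.DiophantineDichotomy

/-!
Sketch for crux-ideate stmt-Schanuel-6118 (EPiSimultaneousType), ideator k = 1, card
`siegel-window-transfer`.  Only STATEMENTS (Props) — no skeleton, no proofs.
-/

namespace Summit.Schanuel.Schanuel.Cruxes.EPiSimultaneousType.SiegelWindow

open Summit.Schanuel.Schanuel.Theses.DiophantineDichotomy

noncomputable section

/-- θ = (π, e), as in the route file. -/
def theta : Fin 2 → ℂ := ![(Real.pi : ℂ), (Real.exp 1 : ℂ)]

/-- "ξ is a root of a nonzero integer polynomial of degree ≤ d and naive height ≤ H" (the per-coordinate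
clause of the crux). -/
def RootOf (d H : ℕ) (ξ : ℂ) : Prop :=
  ∃ P : Polynomial ℤ, P ≠ 0 ∧ P.natDegree ≤ d ∧ (∀ k, |P.coeff k| ≤ (H : ℤ)) ∧ Polynomial.aeval ξ P = 0

/-- Fel'dman / Nesterenko–Waldschmidt (math/0002047 Thm 1 with θ = πi, α = −1, β = iξ; Thm 2 for
real ξ; Bugeaud 2004 p.183): approximation measure for π, LINEAR in the degree up to (1 + log d).
Named-fact-shaped hypothesis, to be vendored in Literature. -/
def PiApproxMeasure : Prop :=
  ∃ c : ℝ, 0 < c ∧ ∀ (d H : ℕ) (ξ : ℂ), 1 ≤ d → 3 ≤ H → RootOf d H ξ →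
    Real.exp (-(c * d * (Real.log H + d * Real.log d) * (1 + Real.log d))) ≤ ‖(Real.pi : ℂ) - ξ‖

/-- Approximation measure for e with degree exponent ν.  KNOWN for ν = 2 (Nesterenko–Waldschmidt
math/0002047 Thm 4: 76000·d²(log L + d), κ = 3); OPEN for every ν < 2 ("any power saving in the
degree aspect for e"; e is an S-number of type 1 by Popken–Mahler, Bugeaud 2004 p.83, which is
the H → ∞ shadow of ν = 1). The transfer needs some ν < 2/(1+η). -/
def EApproxMeasure (ν : ℝ) : Prop :=
  ∃ c κ : ℝ, 0 < c ∧ ∀ (d H : ℕ) (ξ : ℂ), 1 ≤ d → 3 ≤ H → RootOf d H ξ →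
    Real.exp (-(c * ((d : ℝ) ^ ν * Real.log H + (d : ℝ) ^ κ))) ≤ ‖(Real.exp 1 : ℂ) - ξ‖

/-- Measure of algebraic independence of (π, e) with degree exponent `2 + η`, LINEAR in the
log-height (`η = 0` is the box-principle-optimal shape; the transfer needs `η < 1`).  OPEN — a
quantitative form of e ⊥ π; conditional input of the line, not a lemma. -/
def PolyPairMeasure (η : ℝ) : Prop :=
  ∃ C k : ℝ, 0 < C ∧ ∀ (Q : MvPolynomial (Fin 2) ℤ) (Hq : ℕ), Q ≠ 0 → 2 ≤ Hq →
    (∀ m, |Q.coeff m| ≤ (Hq : ℤ)) →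
    Real.exp (-(C * (((Q.totalDegree : ℝ) + 1) ^ (2 + η) * Real.log Hq +
      ((Q.totalDegree : ℝ) + 1) ^ k))) ≤ ‖MvPolynomial.aeval theta Q‖

/-- THE LEVER (pure arithmetic, provable now modulo vendoring Bombieri–Gubler Thm 2.9.19 with K = ℚ:
a nonzero INTEGER solution of one linear equation with coefficients in a number field F of degree
r, N unknowns, of height ≤ (√N·H(row))^{r/(N−r)} — no discriminant of F).  For γ algebraic with
[ℚ(γ):ℚ] ≤ r and every δ with (δ+1)(δ+2)/2 ≥ 2r there is Q ∈ ℤ[x,y] ∖ 0 of total degree ≤ δ with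
Q(γ) = 0 and log-height ≤ (4r/δ)(h(γ 0) + h(γ 1)) + 2 log(δ+2), where h = Weil height, bounded
here through `RootOf` by (log H + log(d+1))/deg. -/
def SiegelRelation : Prop :=
  ∀ (r δ d₁ d₂ H : ℕ) (γ : Fin 2 → ℂ), 1 ≤ r → 1 ≤ d₁ → 1 ≤ d₂ → 2 ≤ H →
    Module.finrank ℚ ↥(IntermediateField.adjoin ℚ (Set.range γ)) ≤ r →
    (∀ i, IsAlgebraic ℚ (γ i)) →
    Module.finrank ℚ ↥(IntermediateField.adjoin ℚ ({γ 0} : Set ℂ)) = d₁ →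
    Module.finrank ℚ ↥(IntermediateField.adjoin ℚ ({γ 1} : Set ℂ)) = d₂ →
    RootOf r H (γ 0) → RootOf r H (γ 1) → 4 * r ≤ (δ + 1) * (δ + 2) →
    ∃ (Q : MvPolynomial (Fin 2) ℤ) (Hq : ℕ), Q ≠ 0 ∧ Q.totalDegree ≤ δ ∧
      MvPolynomial.aeval γ Q = 0 ∧ (∀ m, |Q.coeff m| ≤ (Hq : ℤ)) ∧ 2 ≤ Hq ∧
      Real.log Hq ≤ (4 * r / δ) * ((Real.log H + Real.log (r + 1)) / d₁ +
        (Real.log H + Real.log (r + 1)) / d₂) + 2 * Real.log (δ + 2)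

/-- FIRST LEMMA OF THE LINE (conditional transfer, provable now from `SiegelRelation`, the two
single-variable measures and the mean-value inequality |Q(θ)| ≤ ‖∇Q‖·‖θ − γ‖):
quantitative e ⊥ π with degree exponent < 3 + any power saving below d² for e ⟹ the crux, with
a = max((3+η)/4, ν(3+η)/(2(1+ν))) + ε < 1. -/
def SiegelWindowTransfer : Prop :=
  ∀ η ν : ℝ, 0 ≤ η → η < 1 → 1 ≤ ν → ν < 2 / (1 + η) →
    PolyPairMeasure η → EApproxMeasure ν → PiApproxMeasure → EPiSimultaneousType

/-- Exchange rate at the optimum (remark): a box-optimal pair measure (η = 0) and a Fel'dman-quality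
measure for e (ν = 1) give the crux for every a > 3/4; the generic truth a = 1/2 + ε would follow
from the same lever with the case split made at min(deg γ 0, deg γ 1) ≍ d^{1/2}. -/
def ExchangeRateRemark : Prop :=
  PolyPairMeasure 0 → EApproxMeasure 1 → PiApproxMeasure →
    ∀ a : ℝ, 3 / 4 < a → a < 1 → ∃ b C : ℝ, 0 < C ∧ ∀ (d H : ℕ) (γ : Fin 2 → ℂ),
      Module.finrank ℚ ↥(IntermediateField.adjoin ℚ (Set.range γ)) ≤ d →
      (∀ i, RootOf d H (γ i)) →
      Real.exp (-(C * ((d : ℝ) ^ a * Real.log H + (d : ℝ) ^ b))) ≤ ‖γ - theta‖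

end

end Summit.Schanuel.Schanuel.Cruxes.EPiSimultaneousType.SiegelWindow
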